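import Literature.Analysis.Complex.ObreschkoffTheorem
import Mathlib.Analysis.SpecialFunctions.ExpDeriv
import Mathlib.Algebra.Polynomial.Taylor
import HarnessLib

/-!
# Jensen polynomials of `e^{βz} P(z)`: the exponential factor is a Taylor shift (proved)

Trunk `Literature/Analysis/Complex`, grouping namespace `Literature.Analysis.Complex.KimLee`
(the machinery of Y.-O. Kim, J. Lee, *A note on the zeros of Jensen polynomials*, arXiv:2105.05386,
proof of Thm. 1, in genus one).

Kim–Lee prove that the degree-`d` Jensen polynomial `J(f; d) = Σ_k (d choose k) f⁽ᵏ⁾(0) z^k` of a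
real entire function `f` of order `< 2` whose zeros lie in the sector `S(δ)`, `d δ² ≤ 1`, is
hyperbolic, by approximating `f` locally uniformly by real polynomials `P_k` with
`Z(P_k) ⊂ Z(f) ∪ ℝ` (genus-one Hadamard product, `e^{bz} = lim (1 + bz/k)^k`) and applying
Obreschkoff's theorem (the tree's
`Literature.Analysis.Complex.Obreschkoff.splits_jensenPoly_taylorSeq_of_roots_mem_sector`). The
tree has no genus-one Hadamard theorem; the companion file `JensenPolynomialSectorGenusOne.lean`
instead approximates `f` near `0` by functions `e^{βz} P(z)` (`β ∈ ℝ`, `P` a real polynomial with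
zeros among those of `f`), using Titchmarsh's lemma on the logarithmic derivative. This file
supplies the one algebraic fact needed about such functions:

**Theorem** (`splits_jensenPoly_exp_mul`). If `P ∈ ℝ[X]` has all its complex zeros in `S(δ)`,
`d δ² ≤ 1` and `β ∈ ℝ`, then `J(e^{βz}P; d)` is hyperbolic.

Indeed `(e^{βz}P)⁽ⁿ⁾(0) = Σ_i (n choose i) βⁿ⁻ⁱ P⁽ⁱ⁾(0)` (`iteratedDeriv_exp_mul`, Leibniz for the
exponential factor), which for `n ≤ d` is the Taylor sequence of the polynomial `E_d(βX) · P`,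
`E_d(Y) = Σ_{k ≤ d} Y^k/k!` (`taylorSeq_expTrunc_mul`); and since `E_d(βD) Q = Q(X + β)` for
`deg Q ≤ d` (Taylor's formula, `aeval_derivOp_expTrunc_apply`), the reflected Jensen polynomial
`X^d J(e^{βz}P; d)(1/X) = (E_d(βD) P(D)) X^d = (P(D) X^d)(X + β)` is a translate of `P(D) X^d`,
which is hyperbolic by Obreschkoff's theorem. (Equivalently:
`J(e^{βz}P; d)(X) = (1 + βX)^d · J(P; d)(X/(1 + βX))`.)

## References

* [KimLee2021] Y.-O. Kim, J. Lee, *A note on the zeros of Jensen polynomials*, arXiv:2105.05386,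
  Thm. 1 and its proof, Thm. 3 (Obreschkoff) and Corollary (read: pp. 1–2).
-/

noncomputable section

open Polynomial Finset Filter
open _root_.Complex
open scoped Nat

namespace Literature.Analysis.Complex.KimLee

open Literature.Analysis.Complex.PolyaSchur Literature.Analysis.Complex.Obreschkoff
  Literature.Analysis.TotalPositivity

/-! ### Leibniz' rule for an exponential factor -/

/-- Pascal's rule for binomially weighted sums:
`β Σ_{i≤n} (n choose i) βⁿ⁻ⁱ gᵢ + Σ_{i≤n} (n choose i) βⁿ⁻ⁱ g_{i+1} = Σ_{i≤n+1} (n+1 choose i) βⁿ⁺¹⁻ⁱ gᵢ`.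
[folklore] -/
theorem pascal_sum (β : ℂ) (g : ℕ → ℂ) (n : ℕ) :
    β * (∑ i ∈ range (n + 1), (n.choose i : ℂ) * β ^ (n - i) * g i) +
        ∑ i ∈ range (n + 1), (n.choose i : ℂ) * β ^ (n - i) * g (i + 1) =
      ∑ i ∈ range (n + 2), ((n + 1).choose i : ℂ) * β ^ (n + 1 - i) * g i := by
  -- peel off `i = 0` on the right and use Pascal's rule
  rw [sum_range_succ' (fun i => ((n + 1).choose i : ℂ) * β ^ (n + 1 - i) * g i)]
  simp only [Nat.choose_succ_succ, Nat.cast_add, Nat.succ_sub_succ_eq_sub, Nat.choose_zero_right,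
    Nat.cast_one, one_mul, Nat.sub_zero, add_mul, sum_add_distrib]
  -- the first sum on the right: `Σ_{i<n+1} (n choose i) β^{n-i} g (i+1)` is the second on the left
  -- the second: `Σ_{i<n+1} (n choose (i+1)) β^{n-i} g(i+1) + β^{n+1} g 0 = β Σ (n choose i) β^{n-i} g i`
  have h1 : β * ∑ i ∈ range (n + 1), (n.choose i : ℂ) * β ^ (n - i) * g i =
      ∑ i ∈ range (n + 1), (n.choose i : ℂ) * β ^ (n + 1 - i) * g i := by
    rw [mul_sum]
    refine sum_congr rfl fun i hi => ?_
    rw [mem_range] at hi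
    rw [show n + 1 - i = (n - i) + 1 by omega, pow_succ]
    ring
  have h2 : ∑ i ∈ range (n + 1), (n.choose i : ℂ) * β ^ (n + 1 - i) * g i =
      (∑ i ∈ range n, (n.choose (i + 1) : ℂ) * β ^ (n - i) * g (i + 1)) + β ^ (n + 1) * g 0 := by
    rw [sum_range_succ' (fun i => (n.choose i : ℂ) * β ^ (n + 1 - i) * g i)]
    simp only [Nat.succ_sub_succ_eq_sub, Nat.choose_zero_right, Nat.cast_one, one_mul, Nat.sub_zero]
  have h3 : ∑ i ∈ range (n + 1), (n.choose (i + 1) : ℂ) * β ^ (n - i) * g (i + 1) =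
      ∑ i ∈ range n, (n.choose (i + 1) : ℂ) * β ^ (n - i) * g (i + 1) := by
    rw [sum_range_succ, Nat.choose_succ_self, Nat.cast_zero, zero_mul, zero_mul, add_zero]
  rw [h1, h2, h3]
  ring

/-- Derivative of `z ↦ e^{βz}`. [folklore] -/
theorem hasDerivAt_exp_const_mul (β z : ℂ) :
    HasDerivAt (fun w : ℂ => exp (β * w)) (exp (β * z) * β) z := by
  have h : HasDerivAt (fun w : ℂ => exp (β * w)) (exp (β * z) * (β * 1)) z :=
    (Complex.hasDerivAt_exp (β * z)).comp z ((hasDerivAt_id z).const_mul β)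
  rwa [mul_one] at h

/-- **Leibniz' rule for an exponential factor.** For `G` entire and `β ∈ ℂ`,
`(e^{βz} G)⁽ⁿ⁾(z) = e^{βz} Σ_{i ≤ n} (n choose i) βⁿ⁻ⁱ G⁽ⁱ⁾(z)`. [folklore] -/
theorem iteratedDeriv_exp_mul {G : ℂ → ℂ} (hG : Differentiable ℂ G) (β : ℂ) (n : ℕ) :
    iteratedDeriv n (fun z => exp (β * z) * G z) = fun z =>
      exp (β * z) * ∑ i ∈ range (n + 1), (n.choose i : ℂ) * β ^ (n - i) * iteratedDeriv i G z := by
  induction n with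
  | zero => funext z; simp
  | succ n ih =>
    rw [iteratedDeriv_succ, ih]
    funext z
    -- derivative of the sum
    have hS : HasDerivAt
        (fun w => ∑ i ∈ range (n + 1), (n.choose i : ℂ) * β ^ (n - i) * iteratedDeriv i G w)
        (∑ i ∈ range (n + 1), (n.choose i : ℂ) * β ^ (n - i) * iteratedDeriv (i + 1) G z) z := by
      refine HasDerivAt.fun_sum fun i _ => ?_
      have h := ((differentiable_iteratedDeriv hG i) z).hasDerivAt
      rw [← iteratedDeriv_succ] at h
      exact h.const_mul _
    have hprod : HasDerivAt
        (fun w => exp (β * w) * ∑ i ∈ range (n + 1), (n.choose i : ℂ) * β ^ (n - i) * iteratedDeriv i G w)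
        (exp (β * z) * β * ∑ i ∈ range (n + 1), (n.choose i : ℂ) * β ^ (n - i) * iteratedDeriv i G z +
          exp (β * z) * ∑ i ∈ range (n + 1), (n.choose i : ℂ) * β ^ (n - i) * iteratedDeriv (i + 1) G z)
        z := (hasDerivAt_exp_const_mul β z).mul hS
    rw [hprod.deriv, ← pascal_sum]
    ring

/-- At the origin: `(e^{βz} G)⁽ⁿ⁾(0) = Σ_{i ≤ n} (n choose i) βⁿ⁻ⁱ G⁽ⁱ⁾(0)`. [folklore] -/
theorem iteratedDeriv_exp_mul_zero {G : ℂ → ℂ} (hG : Differentiable ℂ G) (β : ℂ) (n : ℕ) :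
    iteratedDeriv n (fun z => exp (β * z) * G z) 0 =
      ∑ i ∈ range (n + 1), (n.choose i : ℂ) * β ^ (n - i) * iteratedDeriv i G 0 := by
  rw [iteratedDeriv_exp_mul hG]
  simp

/-! ### The truncated exponential `E_d(βX) = Σ_{k ≤ d} βᵏ Xᵏ / k!` as an operator -/

/-- **Taylor's formula for polynomials as an operator identity:** for `deg p ≤ d`,
`E_d(βD) p = Σ_{k ≤ d} βᵏ p⁽ᵏ⁾/k! = p(X + β)`. [folklore] -/
theorem aeval_derivOp_expTrunc_apply (β : ℝ) (d : ℕ) {p : ℝ[X]} (hp : p.natDegree ≤ d) :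
    aeval derivOp (∑ k ∈ range (d + 1), C (β ^ k / k !) * X ^ k) p = taylor β p := by
  set E : ℝ[X] := ∑ k ∈ range (d + 1), C (β ^ k / k !) * X ^ k with hE
  -- both sides are linear in `p`; check on `X^m`, `m ≤ d`
  have key : ∀ m ≤ d, aeval derivOp E (X ^ m : ℝ[X]) = (X + C β) ^ m := by
    intro m hm
    rw [hE, map_sum, LinearMap.sum_apply]
    have hterm : ∀ k, aeval derivOp (C (β ^ k / k !) * X ^ k) (X ^ m : ℝ[X]) =
        (β ^ k / k ! * (m.descFactorial k : ℝ)) • X ^ (m - k) := fun k => by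
      rw [C_mul_X_pow_eq_monomial, aeval_derivOp_monomial_apply, iterate_derivative_X_pow_eq_smul,
        smul_smul]
    simp only [hterm]
    -- terms with `k > m` vanish
    rw [show d + 1 = (m + 1) + (d - m) by omega, sum_range_add]
    have hvan : ∑ k ∈ range (d - m), (β ^ (m + 1 + k) / (m + 1 + k)! *
        ((m.descFactorial (m + 1 + k) : ℕ) : ℝ)) • (X : ℝ[X]) ^ (m - (m + 1 + k)) = 0 := by
      refine sum_eq_zero fun k _ => ?_
      rw [Nat.descFactorial_eq_zero_iff_lt.2 (by omega), Nat.cast_zero, mul_zero, zero_smul]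
    rw [hvan, add_zero, add_pow, ← sum_range_reflect]
    refine sum_congr rfl fun k hk => ?_
    rw [mem_range] at hk
    have hkm : k ≤ m := by omega
    rw [show m + 1 - 1 - k = m - k by omega, Nat.descFactorial_eq_factorial_mul_choose,
      Nat.choose_symm hkm, show m - (m - k) = k by omega, Nat.cast_mul, smul_eq_C_mul]
    have hk0 : ((m - k)! : ℝ) ≠ 0 := by exact_mod_cast (m - k).factorial_ne_zero
    rw [show β ^ (m - k) / ((m - k)! : ℝ) * (((m - k)! : ℝ) * ((m.choose k : ℕ) : ℝ)) =
      β ^ (m - k) * ((m.choose k : ℕ) : ℝ) by field_simp]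
    rw [map_mul, map_pow, map_natCast]
    ring
  -- linearity
  conv_lhs => rw [p.as_sum_range' (d + 1) (Nat.lt_succ_of_le hp)]
  conv_rhs => rw [p.as_sum_range' (d + 1) (Nat.lt_succ_of_le hp)]
  rw [map_sum (aeval derivOp E), map_sum (taylor β)]
  refine sum_congr rfl fun m hm => ?_
  rw [mem_range] at hm
  rw [← C_mul_X_pow_eq_monomial, ← smul_eq_C_mul, LinearMap.map_smul, LinearMap.map_smul,
    key m (by omega), taylor_X_pow]

/-- Hence `(E_d(βX) · q)(D) p = (q(D) p)(X + β)` for `deg p ≤ d`. [folklore] -/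
theorem aeval_derivOp_expTrunc_mul_apply (β : ℝ) (d : ℕ) (q : ℝ[X]) {p : ℝ[X]}
    (hp : p.natDegree ≤ d) :
    aeval derivOp ((∑ k ∈ range (d + 1), C (β ^ k / k !) * X ^ k) * q) p =
      taylor β (aeval derivOp q p) := by
  rw [map_mul, Module.End.mul_apply]
  exact aeval_derivOp_expTrunc_apply β d ((natDegree_aeval_derivOp_apply_le q p).trans hp)

/-- Coefficients of `E_d(βX)`: `βⁱ/i!` for `i ≤ d`. [folklore] -/
theorem coeff_expTrunc (β : ℝ) (d i : ℕ) :
    (∑ k ∈ range (d + 1), C (β ^ k / k !) * X ^ k : ℝ[X]).coeff i =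
      if i < d + 1 then β ^ i / i ! else 0 := by
  rw [finsetSum_coeff]
  simp only [coeff_C_mul_X_pow]
  rw [sum_ite_eq (range (d + 1)) i]
  simp only [mem_range]

/-- **The Taylor sequence of `E_d(βX) · q` is the binomial `β`-transform of that of `q`:** for
`n ≤ d`, `taylorSeq (E_d(βX) q) n = Σ_{i ≤ n} (n choose i) βⁿ⁻ⁱ taylorSeq q i`
(the Taylor coefficients of `e^{βz} q(z)` up to order `d`). [folklore] -/
theorem taylorSeq_expTrunc_mul (β : ℝ) (d : ℕ) (q : ℝ[X]) {n : ℕ} (hn : n ≤ d) :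
    taylorSeq ((∑ k ∈ range (d + 1), C (β ^ k / k !) * X ^ k) * q) n =
      ∑ i ∈ range (n + 1), (n.choose i : ℝ) * β ^ (n - i) * taylorSeq q i := by
  rw [taylorSeq, coeff_mul, Nat.sum_antidiagonal_eq_sum_range_succ_mk, mul_sum]
  simp only [coeff_expTrunc]
  rw [← sum_range_reflect]
  refine sum_congr rfl fun i hi => ?_
  rw [mem_range] at hi
  have hin : i ≤ n := by omega
  rw [show n + 1 - 1 - i = n - i by omega, if_pos (by omega), taylorSeq,
    show n - (n - i) = i by omega]
  have hfac : ((n - i)! : ℝ) ≠ 0 := by exact_mod_cast (n - i).factorial_ne_zero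
  have hchoose : (n.choose i : ℝ) * (i ! : ℝ) * ((n - i)! : ℝ) = n ! := by
    exact_mod_cast Nat.choose_mul_factorial_mul_factorial hin
  rw [← hchoose]
  field_simp

/-- The Jensen polynomial `J^{d,0}` only depends on the first `d + 1` terms of the sequence.
[folklore] -/
theorem jensenPoly_congr {γ γ' : ℕ → ℝ} {d : ℕ} (h : ∀ k ≤ d, γ k = γ' k) :
    Literature.NumberTheory.LFunctions.jensenPoly γ d 0 =
      Literature.NumberTheory.LFunctions.jensenPoly γ' d 0 := by
  ext j
  simp only [coeff_jensenPoly, zero_add]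
  split_ifs with hj
  · rw [h j hj]
  · rfl

/-! ### Jensen polynomials of `e^{βz} P(z)` -/

/-- The Taylor coefficients of `H(z) = e^{βz} q(z)` (`q` a real polynomial, `β` real): for every
`n`, `Re H⁽ⁿ⁾(0) = Σ_{i ≤ n} (n choose i) βⁿ⁻ⁱ · i! q_i`. [folklore] -/
theorem re_iteratedDeriv_exp_mul_polynomial (β : ℝ) (q : ℝ[X]) (n : ℕ) :
    (iteratedDeriv n (fun z => exp ((β : ℂ) * z) * (q.map (algebraMap ℝ ℂ)).eval z) 0).re =
      ∑ i ∈ range (n + 1), (n.choose i : ℝ) * β ^ (n - i) * taylorSeq q i := by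
  rw [iteratedDeriv_exp_mul_zero (Polynomial.differentiable _)]
  have h : ∀ i, iteratedDeriv i (fun z => (q.map (algebraMap ℝ ℂ)).eval z) 0 =
      ((taylorSeq q i : ℝ) : ℂ) := fun i => by
    have : (fun z => (q.map (algebraMap ℝ ℂ)).eval z) =
        fun z => (q.map Complex.ofRealHom).eval z := rfl
    rw [this, iteratedDeriv_polynomial_eval_zero, coeff_map, taylorSeq]
    simp
  simp only [h]
  have hsum : (∑ i ∈ range (n + 1), (n.choose i : ℂ) * (β : ℂ) ^ (n - i) * ((taylorSeq q i : ℝ) : ℂ)) =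
      ((∑ i ∈ range (n + 1), (n.choose i : ℝ) * β ^ (n - i) * taylorSeq q i : ℝ) : ℂ) := by
    push_cast; rfl
  rw [hsum, Complex.ofReal_re]

/-- **Jensen polynomials of `e^{βz} P(z)` for `Z(P) ⊂ S(δ)` are hyperbolic up to degree `δ⁻²`.**
If all complex zeros of the real polynomial `q` lie in Kim–Lee's sector `S(δ) = {|Im z| ≤ δ|z|}`,
`d δ² ≤ 1` and `β ∈ ℝ`, then `J^{d,0}` of the sequence `(Re H⁽ᵏ⁾(0))_k`, `H(z) = e^{βz} q(z)` — i.e.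
`J(H; d) = Σ_k (d choose k) H⁽ᵏ⁾(0) X^k` — has only real zeros:
`X^d J(H;d)(1/X) = (q(D) X^d)(X + β)` and Obreschkoff's theorem.
[cite: KimLee2021, Corollary to Theorem 3 (with the factor `e^{βz}`)] -/
theorem splits_jensenPoly_exp_mul {q : ℝ[X]} {δ : ℝ} (hq : ∀ z : ℂ, aeval z q = 0 → z ∈ sector δ)
    {d : ℕ} (hd : (d : ℝ) * δ ^ 2 ≤ 1) (β : ℝ) :
    (Literature.NumberTheory.LFunctions.jensenPoly
      (fun k => (iteratedDeriv k (fun z => exp ((β : ℂ) * z) * (q.map (algebraMap ℝ ℂ)).eval z) 0).re)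
        d 0).Splits := by
  set E : ℝ[X] := ∑ k ∈ range (d + 1), C (β ^ k / k !) * X ^ k with hE
  have hcoef : ∀ k ≤ d,
      (iteratedDeriv k (fun z => exp ((β : ℂ) * z) * (q.map (algebraMap ℝ ℂ)).eval z) 0).re =
        taylorSeq (E * q) k := fun k hk => by
    rw [re_iteratedDeriv_exp_mul_polynomial, hE, taylorSeq_expTrunc_mul β d q hk]
  rw [jensenPoly_congr hcoef, jensenPoly_taylorSeq_eq_reflect, hE,
    aeval_derivOp_expTrunc_mul_apply β d q (natDegree_X_pow_le d)]
  have hsplit : (aeval derivOp q (X ^ d : ℝ[X])).Splits :=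
    Obreschkoff.splits_aeval_derivOp_of_roots_mem_sector hd q (X ^ d) hq (Splits.X_pow d)
      (natDegree_X_pow_le d)
  refine splits_reflect (hsplit.taylor β) ?_
  rw [natDegree_taylor]
  exact (natDegree_aeval_derivOp_apply_le _ _).trans (natDegree_X_pow_le d)

end Literature.Analysis.Complex.KimLee
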